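import Literature.Probability.LatticeModels.LocalPerturbationClusterExpansion
import HarnessLib

/-!
# Crux `IR` (stmt-QuantumFields-19354), lane B: far-cell decay in the Kotecký–Preiss regime, part 2∕3 — clusters are connected and long;
# the `τ`-weighted pinned Kotecký–Preiss bound (generic over the tree's local-perturbation layer; route-independent, Theses-free)

Helper module for item `stmt-QuantumFields-19354` (`--supports`; it closes nothing), lane `ym-19354-onsetsc-p2` (g2; owner R118 (3) GO).
Part 2 of the three-file proof of `norm_pertExpect_sub_pertExpect_sdiff_le` (part 3, `Theorems/IR/BlockedActivityKPDecay`); independent of part 1.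

* §4 `isRConnected_singleton`, `IsRConnected.insert_of_adj`, **`isRConnected_biUnion_of_isPolymerCluster`** (the union of a polymer cluster —
  tree `IsPolymerCluster` for the geometric incompatibility `GeomInc R` — of `R`-connected cell sets is `R`-connected; so a cluster of the
  extended system through `∗` and `D` has at least as many cells as an `extAdj`-connected set joining them, part 3).
* §5 **`sum_norm_truncatedWeight_touching_le_weighted`**: the tree's pinned bound `sum_norm_truncatedWeight_touching_le` ([KP86, (4)]) re-run
  with the decay weight `d(Y) = τ · #Y`: under `τ ≥ 0` and `e^{1+τ} ε (Δ+1)² ≤ 1∕2`,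
  `Σ_{𝒞 ⊆ 𝒫(C), 𝒞 ∼ X} ‖Φ^T(𝒞)‖ e^{τ Σ_{Y ∈ 𝒞} #Y} ≤ #X (Δ+1) 2 e^{1+τ} ε` — the room `e^{τ·size}` that pays for long clusters.

HONEST FRAMING: an abstract expansion estimate; nothing about Yang–Mills; not a gap, not Clay.  No `sorry`; axioms ⊆ {propext,
Classical.choice, Quot.sound}; no global instances (local `haveI` only), no notation.
Refs: KoteckyPreiss1986 (1), (2), (5); FriedliVelenik2017 §5.7; SeilerLNP1982 Ch. 2; OsterwalderSeilerAnnPhys1978 §3.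
-/

set_option autoImplicit false

noncomputable section

open MeasureTheory ProbabilityTheory Finset
open Literature.Probability.LatticeModels

namespace Summit.QuantumFields.YangMills.Cruxes.IR.BlockedActivity.KP

/-! ## §4 Combinatorics: clusters are connected; clusters from `∗` to `D` are long -/

section Combinatorics

variable {W : Type*} [DecidableEq W] {R' : W → W → Prop}

omit [DecidableEq W] in
/-- A singleton is `R`-connected. -/
theorem isRConnected_singleton (x : W) : IsRConnected R' ({x} : Finset W) := by
  refine ⟨singleton_nonempty x, fun v hv w hw => ?_⟩
  rw [mem_singleton] at hv hw
  subst hv; subst hw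
  exact Relation.ReflTransGen.refl

/-- Adding an `R`-neighbour of a member keeps a set `R`-connected. -/
theorem IsRConnected.insert_of_adj (hR' : ∀ x y, R' x y → R' y x) {A : Finset W} (hA : IsRConnected R' A) {a b : W}
    (ha : a ∈ A) (hab : R' a b) : IsRConnected R' (insert b A) := by
  classical
  refine ⟨⟨b, mem_insert_self _ _⟩, ?_⟩
  -- every member is reachable from `a` inside `insert b A`
  have lift : ∀ v ∈ A, ∀ w ∈ A,
      Relation.ReflTransGen (fun x y => R' x y ∧ x ∈ insert b A ∧ y ∈ insert b A) v w := by
    have hle : (fun x y => R' x y ∧ x ∈ A ∧ y ∈ A) ≤ (fun x y => R' x y ∧ x ∈ insert b A ∧ y ∈ insert b A) :=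
      fun x y hxy => ⟨hxy.1, mem_insert_of_mem hxy.2.1, mem_insert_of_mem hxy.2.2⟩
    exact fun v hv w hw => Relation.ReflTransGen.mono hle v w (hA.2 v hv w hw)
  have hab' : Relation.ReflTransGen (fun x y => R' x y ∧ x ∈ insert b A ∧ y ∈ insert b A) a b :=
    Relation.ReflTransGen.single ⟨hab, mem_insert_of_mem ha, mem_insert_self _ _⟩
  have hba' : Relation.ReflTransGen (fun x y => R' x y ∧ x ∈ insert b A ∧ y ∈ insert b A) b a :=
    Relation.ReflTransGen.single ⟨hR' _ _ hab, mem_insert_self _ _, mem_insert_of_mem ha⟩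
  have from_a : ∀ w ∈ insert b A, Relation.ReflTransGen (fun x y => R' x y ∧ x ∈ insert b A ∧ y ∈ insert b A) a w := by
    intro w hw
    rcases mem_insert.1 hw with rfl | hw
    · exact hab'
    · exact lift a ha w hw
  have to_a : ∀ v ∈ insert b A, Relation.ReflTransGen (fun x y => R' x y ∧ x ∈ insert b A ∧ y ∈ insert b A) v a := by
    intro v hv
    rcases mem_insert.1 hv with rfl | hv
    · exact hba'
    · exact lift v hv a ha
  exact fun v hv w hw => (to_a v hv).trans (from_a w hw)

/-- **The union of a polymer cluster of `R`-connected sets is `R`-connected.** -/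
theorem isRConnected_biUnion_of_isPolymerCluster {𝒞 : Finset (Finset W)} (hne : 𝒞.Nonempty)
    (hconn : ∀ X ∈ 𝒞, IsRConnected R' X) (hcl : IsPolymerCluster (GeomInc R') 𝒞) : IsRConnected R' (𝒞.biUnion id) := by
  classical
  set U := 𝒞.biUnion id with hU
  have hmemU : ∀ {X}, X ∈ 𝒞 → ∀ {x}, x ∈ X → x ∈ U := fun hX x hx => mem_biUnion.2 ⟨_, hX, hx⟩
  -- paths inside a polymer lift to paths inside `U`
  have lift : ∀ X ∈ 𝒞, ∀ v ∈ X, ∀ w ∈ X, Relation.ReflTransGen (fun x y => R' x y ∧ x ∈ U ∧ y ∈ U) v w := by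
    intro X hX v hv w hw
    have hle : (fun x y => R' x y ∧ x ∈ X ∧ y ∈ X) ≤ (fun x y => R' x y ∧ x ∈ U ∧ y ∈ U) :=
      fun x y hxy => ⟨hxy.1, hmemU hX hxy.2.1, hmemU hX hxy.2.2⟩
    exact Relation.ReflTransGen.mono hle v w ((hconn X hX).2 v hv w hw)
  obtain ⟨X₀, hX₀⟩ := hne
  obtain ⟨v₀, hv₀⟩ := (hconn X₀ hX₀).1
  refine ⟨⟨v₀, hmemU hX₀ hv₀⟩, fun v hv w hw => ?_⟩
  -- rerun with base point `v`
  obtain ⟨Xv, hXv, hvX⟩ := mem_biUnion.1 hv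
  set 𝒞₁ := 𝒞.filter fun X => ∀ x ∈ X, Relation.ReflTransGen (fun x y => R' x y ∧ x ∈ U ∧ y ∈ U) v x with h𝒞₁
  have hsub : 𝒞₁ ⊆ 𝒞 := filter_subset _ _
  have hXv₁ : Xv ∈ 𝒞₁ := mem_filter.2 ⟨hXv, fun x hx => lift Xv hXv v hvX x hx⟩
  have hall : 𝒞 \ 𝒞₁ = ∅ := by
    by_contra hne'
    obtain ⟨X₁, hX₁, X₂, hX₂, hinc⟩ := hcl 𝒞₁ hsub ⟨Xv, hXv₁⟩ (nonempty_iff_ne_empty.2 hne')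
    have hX₂𝒞 : X₂ ∈ 𝒞 := (mem_sdiff.1 hX₂).1
    have hX₂not : X₂ ∉ 𝒞₁ := (mem_sdiff.1 hX₂).2
    have hreach₁ := (mem_filter.1 hX₁).2
    apply hX₂not
    refine mem_filter.2 ⟨hX₂𝒞, ?_⟩
    have key : ∃ b ∈ X₂, Relation.ReflTransGen (fun x y => R' x y ∧ x ∈ U ∧ y ∈ U) v b := by
      rcases hinc with heq | ⟨a, ha, b, hb, hab⟩
      · exact absurd (heq ▸ hX₁ : X₂ ∈ 𝒞₁) hX₂not
      · refine ⟨b, hb, ?_⟩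
        rcases hab with rfl | hab
        · exact hreach₁ a ha
        · exact (hreach₁ a ha).tail ⟨hab, hmemU (hsub hX₁) ha, hmemU hX₂𝒞 hb⟩
    obtain ⟨b, hb, hvb⟩ := key
    exact fun x hx => hvb.trans (lift X₂ hX₂𝒞 b hb x hx)
  obtain ⟨X, hX, hwX⟩ := mem_biUnion.1 hw
  have hX₁ : X ∈ 𝒞₁ := by
    by_contra hX₁
    have : X ∈ 𝒞 \ 𝒞₁ := mem_sdiff.2 ⟨hX, hX₁⟩
    rw [hall] at this
    exact notMem_empty _ this
  exact (mem_filter.1 hX₁).2 w hwX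

end Combinatorics

/-! ## §5 The `τ`-weighted pinned Kotecký–Preiss bound -/

section Weighted

variable {V : Type*} [DecidableEq V] {Ω : Type*} {mΩ : MeasurableSpace Ω} {μ : Measure Ω}
  {R : V → V → Prop} [DecidableRel R] [Std.Symm R] {𝓕 : V → MeasurableSpace Ω} {g : V → Ω → ℂ}
  {ε τ : ℝ} {nbr : V → Finset V} {Δ : ℕ}

omit [DecidableEq V] [DecidableRel R] [Std.Symm R] in
/-- The smallness with decay room `τ ≥ 0` implies the plain KP smallness. -/
theorem smallness_of_weighted {ε' : ℝ} {D : ℕ} (hε : 0 ≤ ε') (hτ : 0 ≤ τ)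
    (hsmall : Real.exp (1 + τ) * ε' * ((D : ℝ) + 1) ^ 2 ≤ 1 / 2) : Real.exp 1 * ε' * ((D : ℝ) + 1) ^ 2 ≤ 1 / 2 := by
  have h1 : Real.exp 1 ≤ Real.exp (1 + τ) := Real.exp_le_exp.2 (by linarith)
  have h2 : 0 ≤ ε' * ((D : ℝ) + 1) ^ 2 := by positivity
  nlinarith


/-- **Pinned cluster sums with an exponential size weight** (the tree's `sum_norm_truncatedWeight_touching_le`, [KP86, (4)], run with the
decay weight `d(Y) = τ #Y`): under `τ ≥ 0` and `e^{1+τ} ε (Δ+1)² ≤ 1∕2`, for every cell set `X`,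
`Σ_{𝒞 ⊆ 𝒫(C), 𝒞 ∼ X} ‖Φ^T(𝒞)‖ e^{τ Σ_{Y ∈ 𝒞} #Y} ≤ #X (Δ+1) 2 e^{1+τ} ε`. -/
theorem sum_norm_truncatedWeight_touching_le_weighted [IsProbabilityMeasure μ] (hΔ : ∀ x, (nbr x).card ≤ Δ)
    (hnbr : ∀ x y, R x y → y ∈ nbr x) (h : IsLocalPerturbation μ R 𝓕 g ε) (hτ : 0 ≤ τ)
    (hsmall : Real.exp (1 + τ) * ε * ((Δ : ℝ) + 1) ^ 2 ≤ 1 / 2) (C X : Finset V) :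
    ∑ 𝒞 ∈ (rconnSubsets R C).powerset with KPTouches (GeomInc R) 𝒞 X,
        ‖truncatedWeight (GeomInc R) (connActivity R μ g) 𝒞‖ * Real.exp (∑ Y ∈ 𝒞, τ * (Y.card : ℝ)) ≤
      X.card * ((Δ : ℝ) + 1) * (2 * (Real.exp (1 + τ) * ε)) := by
  have hR : ∀ x y, R x y → R y x := symm_of_inst
  set L := rconnSubsets R C with hL
  set w := connActivity R μ g with hw
  have hz0 : ∀ Y, ¬ IsRConnected R Y → w Y = 0 := fun Y hY => by simp [hw, connActivity, hY]
  have hz : ∀ Y, ‖w Y‖ ≤ ε ^ Y.card := fun Y => by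
    by_cases hY : IsRConnected R Y
    · simpa [hw, connActivity, hY] using norm_cellActivity_le h Y
    · simp only [hw, connActivity, hY, if_false, norm_zero]; exact pow_nonneg h.nonneg _
  -- the finite-volume KP hypothesis with `a = #·`, `d = τ #·`
  have h1 : ∀ γ ∈ L, ∑ γ' ∈ L with GeomInc R γ' γ,
      ‖w γ'‖ * Real.exp ((γ'.card : ℝ) + (fun Y : Finset V => τ * (Y.card : ℝ)) γ') ≤ (γ.card : ℝ) := by
    intro γ hγ
    exact geomInc_kp_hypothesis hR hΔ hnbr h.nonneg hsmall w hz0 hz L γ hγ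
  have ha : ∀ γ : Finset V, 0 ≤ (γ.card : ℝ) := fun γ => Nat.cast_nonneg _
  have hd : ∀ γ : Finset V, 0 ≤ (fun Y : Finset V => τ * (Y.card : ℝ)) γ := fun γ => by positivity
  have hKP : IsKPVolume (GeomInc R) w (fun X => (X.card : ℝ)) L :=
    isKPVolume_connActivity hΔ hnbr h (smallness_of_weighted h.nonneg hτ hsmall) L
  -- (S) along the path `Φ_t`, then the derivative bound (12)
  have hS : ∀ t ∈ Set.Icc (0 : ℝ) 1, ∀ δ ∈ L, GeomInc R δ X →
      touchSum (GeomInc R) (scaledActivity w (scaleAt (GeomInc R) (fun _ => (1 : ℝ)) X t))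
        (fun Y : Finset V => τ * (Y.card : ℝ)) L δ ≤ (δ.card : ℝ) := by
    intro t ht δ hδ _
    have hc : scaleAt (GeomInc R) (fun _ => (1 : ℝ)) X t ∈ multCube (Finset V) 1 :=
      mem_multCube.2 fun δ' => scaleAt_mem_Icc (fun _ => ⟨zero_le_one, le_rfl⟩) X ht δ'
    have := touchSum_smul_le_of_kp ha hd h1 1 ⟨zero_le_one, le_rfl⟩ _ hc δ hδ
    rwa [one_smul] at this
  have hmain := touchSum_le_of_forall_scaleAt (inc := GeomInc R) hd hKP
    (c := fun _ => (1 : ℝ)) (fun _ => ⟨zero_le_one, le_rfl⟩) (γ := X) hS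
  rw [scaledActivity_one] at hmain
  have hlhs : touchSum (GeomInc R) w (fun Y : Finset V => τ * (Y.card : ℝ)) L X =
      ∑ 𝒞 ∈ L.powerset with KPTouches (GeomInc R) 𝒞 X, ‖truncatedWeight (GeomInc R) w 𝒞‖ *
        Real.exp (∑ Y ∈ 𝒞, τ * (Y.card : ℝ)) := rfl
  rw [hlhs] at hmain
  refine hmain.trans ?_
  have hsum := geomInc_kp_sum_le hR hΔ hnbr h.nonneg hsmall w hz0 hz X
    (L.filter fun Y => GeomInc R Y X) fun Y hY => (mem_filter.1 hY).2
  refine le_trans (le_of_eq ?_) hsum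
  refine sum_congr rfl fun Y _ => ?_
  simp only

end Weighted

end Summit.QuantumFields.YangMills.Cruxes.IR.BlockedActivity.KP

end
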